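import Mathlib
import HarnessLib
import Literature.NumberTheory.LFunctions.SuzukiSingleOperatorKernelProofs
import Summits.RiemannHypothesis.RiemannHypothesis.Theses.DeBrangesSuzukiDoor

/-!
# RiemannHypothesis / DeBrangesSuzukiDoor — crux `KernelSupport` (K3, stmt-RiemannHypothesis-19727) PROVED

The route crux K3: for every `θ > 10` Suzuki's single kernel
`K_θ(x) = Re (2π)⁻¹ ∫ Θ_θ(u+i) e^{−i(u+i)x} du` vanishes for `x < 0`. Immediate from the Literature theorem
`Literature.NumberTheory.LFunctions.Suzuki2020_thm12_Kiii` ([Su20] = Suzuki, ASPM 84 (2020), arXiv:1907.07302,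
Thm 1.2 (K-iii), PROVED in the tree for every `θ > 1` by rh-columns-lit g2, p408554: uniform symbol decay on the
lines `Im z = b`, line independence by Cauchy's theorem, `b → ∞`). The route decl's `let Θ` / `let K` are
`limTheta θ` / `limKernel θ` by `rfl`. (An independent proof of the three registered K3 stubs by name —
`stub_symbolDecayUniform`, `stub_lineIndependence`, `stub_vanishingGeneric` — is filed separately as `--supports`.)
RH-FREE theorem; nothing here bears on the truth of RH.
-/

noncomputable section

-- D-0017: `Summit.<S>.<S>.…` is the designed namespace of a single-problem summit.
set_option linter.dupNamespace false

namespace Summit.RiemannHypothesis.RiemannHypothesis.Theorems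

/-- **Route `DeBrangesSuzukiDoor`, crux `KernelSupport` (K3, stmt-RiemannHypothesis-19727) — PROVED (RH-FREE).**
For every `θ > 10` and every `x < 0`, `K_θ(x) = 0` ([Su20] Thm 1.2 (K-iii), tree theorem for all `θ > 1`). -/
theorem kernelSupport_proof : Theses.DeBrangesSuzukiDoor.KernelSupport := by
  intro θ hθ Θ K x hx
  exact Literature.NumberTheory.LFunctions.Suzuki2020_thm12_Kiii (θ := θ) (by linarith) hx

end Summit.RiemannHypothesis.RiemannHypothesis.Theorems

end
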